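import Summits.AtomisticToContinuum.Crystallization.Theses.GappedShellCensus
import Literature.Geometry.DiscreteGeometry.DihedralAngleFraction

/-!
# Crux `GappedShellCensus.ShellTrichotomy` (stmt-AtomisticToContinuum-18070), line `Sketch` —
# stub `stub_tCornerMax`

**T-corner bound.**  For a "2 %-regular tetrahedron" `(0, v, a, b)` of `ℝ³` — all six of
`‖v‖, ‖a‖, ‖b‖, |va|, |vb|, |ab|` in `[0.98, 1.02]` — the dihedral angle about the spoke `0v`,
i.e. the angle between the components `perpTo v a`, `perpTo v b` of `a`, `b` orthogonal to `v`,
is at most `arccos (1/4) ≈ 75.52°` (the true supremum is `≈ 75.10°`).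

## Proof

Write `r_v = ‖v‖`, `r_a = ‖a‖`, `r_b = ‖b‖` and `⟪v, a⟫ = x r_v r_a`, `⟪v, b⟫ = y r_v r_b`,
`⟪a, b⟫ = z r_a r_b` (normalised cosines; `⟪v, a⟫ = (r_v² + r_a² − |va|²)/2` by the polarisation
identity).  Then `‖perpTo v a‖² = r_a² (1 − x²)`, `‖perpTo v b‖² = r_b² (1 − y²)` and
`⟪perpTo v a, perpTo v b⟫ = r_a r_b (z − x y)`, so the claim is `16 (z − x y)² ≥ (1 − x²)(1 − y²)`
with `z − x y > 0`.

* Coupled windows (`cos_le_upper`, `lower_le_cos`): `x ≤ X(R)` whenever `r_a ≤ R`, where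
  `X(R) = (1.02² + R² − 0.98²)/(2 · 1.02 · R)`, similarly `y ≤ X(S)` for `r_b ≤ S`, and
  `z ≥ Z(R₁, S₁) = (R₁² + S₁² − 1.02²)/(2 R₁ S₁)` whenever `R₁ ≤ r_a`, `S₁ ≤ r_b`; also
  `0.44 ≤ x, y` and `x, y, z ≤ 0.54`.  Each is a polynomial inequality written as a sum of
  products of nonnegative factors.
* Monotone reduction (`mono_step`, `box_reduce`): `(z − x y)²/(1 − x²)` is decreasing in `x` on
  the window (two-point form: an explicit factorisation through `X − x`), likewise in `y`, and
  increasing in `z`; hence it suffices that `16 (Z − X Y)² ≥ (1 − X²)(1 − Y²)` with `Z > X Y`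
  for the box constants.
* The one-box certificate fails by a hair (`0.237 < 1/4` against the true corner value `0.257`),
  so the radii `r_a`, `r_b` are each split at `0.99`; the four rational certificates are checked
  by `norm_num` (worst value `0.2524 > 1/4`).
-/

noncomputable section

namespace Summit.AtomisticToContinuum.Crystallization.Theorems

open scoped RealInnerProductSpace
open Literature.Geometry.DiscreteGeometry

/-! ### Real-variable lemmas -/

/-- Two-point monotonicity of `x ↦ (z − x y)² / (1 − x²)` (decreasing): cleared of denominators,
for `x ≤ X` with `z ≥ X y`, `y ≥ X z` and `X² ≤ 1`. -/
private theorem mono_step {x X y z : ℝ} (hxX : x ≤ X) (hX : X ^ 2 ≤ 1) (h1 : 0 ≤ z - X * y)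
    (h2 : 0 ≤ y - X * z) :
    (z - X * y) ^ 2 * (1 - x ^ 2) ≤ (z - x * y) ^ 2 * (1 - X ^ 2) := by
  have key : (z - x * y) ^ 2 * (1 - X ^ 2) - (z - X * y) ^ 2 * (1 - x ^ 2) =
      (X - x) * (2 * (z - X * y) * (y - X * z) +
        (X - x) * (y ^ 2 * (1 - X ^ 2) + (z - X * y) ^ 2)) := by
    ring
  have hnonneg : 0 ≤ (X - x) * (2 * (z - X * y) * (y - X * z) +
      (X - x) * (y ^ 2 * (1 - X ^ 2) + (z - X * y) ^ 2)) := by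
    apply mul_nonneg (sub_nonneg.2 hxX)
    apply add_nonneg
    · exact mul_nonneg (mul_nonneg (by norm_num) h1) h2
    · exact mul_nonneg (sub_nonneg.2 hxX)
        (add_nonneg (mul_nonneg (sq_nonneg y) (sub_nonneg.2 hX)) (sq_nonneg _))
  linarith [key, hnonneg]

/-- Reduction to a box certificate: if `0.44 ≤ x ≤ X ≤ 0.54`, `0.44 ≤ y ≤ Y ≤ 0.54`,
`Z ≤ z ≤ 0.54` and the corner `(X, Y, Z)` satisfies `16 (Z − X Y)² ≥ (1 − X²)(1 − Y²)` with
`Z > X Y`, then `16 (z − x y)² ≥ (1 − x²)(1 − y²)` with `z > x y`. -/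
private theorem box_reduce {x y z X Y Z : ℝ} (hx0 : 11 / 25 ≤ x) (hxX : x ≤ X) (hX1 : X ≤ 27 / 50)
    (hy0 : 11 / 25 ≤ y) (hyY : y ≤ Y) (hY1 : Y ≤ 27 / 50) (hZz : Z ≤ z) (hz1 : z ≤ 27 / 50)
    (hN : 0 < Z - X * Y) (hcert : (1 - X ^ 2) * (1 - Y ^ 2) ≤ 16 * (Z - X * Y) ^ 2) :
    0 < z - x * y ∧ (1 - x ^ 2) * (1 - y ^ 2) ≤ 16 * (z - x * y) ^ 2 := by
  have hX0 : 11 / 25 ≤ X := hx0.trans hxX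
  have hY0 : 11 / 25 ≤ Y := hy0.trans hyY
  have hxy : x * y ≤ X * Y := mul_le_mul hxX hyY (by linarith) (by linarith)
  have hpos : 0 < z - x * y := by linarith
  refine ⟨hpos, ?_⟩
  have h1x : 0 ≤ 1 - x ^ 2 := by nlinarith
  have h1y : 0 ≤ 1 - y ^ 2 := by nlinarith
  have h1X : 0 < 1 - X ^ 2 := by nlinarith
  have h1Y : 0 < 1 - Y ^ 2 := by nlinarith
  -- step in `x`
  have hXy : X * y ≤ X * Y := mul_le_mul_of_nonneg_left hyY (by linarith)
  have hXz : X * z ≤ 27 / 50 * (27 / 50) :=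
    (mul_le_mul_of_nonneg_left hz1 (by linarith)).trans
      (mul_le_mul_of_nonneg_right hX1 (by norm_num))
  have s1 : (z - X * y) ^ 2 * (1 - x ^ 2) ≤ (z - x * y) ^ 2 * (1 - X ^ 2) :=
    mono_step hxX (by nlinarith) (by linarith) (by linarith)
  -- step in `y`
  have hYz : Y * z ≤ 27 / 50 * (27 / 50) :=
    (mul_le_mul_of_nonneg_left hz1 (by linarith)).trans
      (mul_le_mul_of_nonneg_right hY1 (by norm_num))
  have s2 : (z - Y * X) ^ 2 * (1 - y ^ 2) ≤ (z - y * X) ^ 2 * (1 - Y ^ 2) :=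
    mono_step hyY (by nlinarith) (by linarith) (by linarith)
  -- step in `z`
  have s3 : (Z - X * Y) ^ 2 ≤ (z - X * Y) ^ 2 := pow_le_pow_left₀ hN.le (by linarith) 2
  have chain : (1 - x ^ 2) * (1 - y ^ 2) * ((1 - X ^ 2) * (1 - Y ^ 2)) ≤
      16 * (z - x * y) ^ 2 * ((1 - X ^ 2) * (1 - Y ^ 2)) :=
    calc (1 - x ^ 2) * (1 - y ^ 2) * ((1 - X ^ 2) * (1 - Y ^ 2))
        = (1 - X ^ 2) * (1 - Y ^ 2) * ((1 - x ^ 2) * (1 - y ^ 2)) := by ring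
      _ ≤ 16 * (Z - X * Y) ^ 2 * ((1 - x ^ 2) * (1 - y ^ 2)) :=
          mul_le_mul_of_nonneg_right hcert (mul_nonneg h1x h1y)
      _ ≤ 16 * (z - X * Y) ^ 2 * ((1 - x ^ 2) * (1 - y ^ 2)) :=
          mul_le_mul_of_nonneg_right (mul_le_mul_of_nonneg_left s3 (by norm_num))
            (mul_nonneg h1x h1y)
      _ = 16 * (1 - x ^ 2) * ((z - Y * X) ^ 2 * (1 - y ^ 2)) := by ring
      _ ≤ 16 * (1 - x ^ 2) * ((z - y * X) ^ 2 * (1 - Y ^ 2)) :=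
          mul_le_mul_of_nonneg_left s2 (by positivity)
      _ = 16 * (1 - Y ^ 2) * ((z - X * y) ^ 2 * (1 - x ^ 2)) := by ring
      _ ≤ 16 * (1 - Y ^ 2) * ((z - x * y) ^ 2 * (1 - X ^ 2)) :=
          mul_le_mul_of_nonneg_left s1 (by positivity)
      _ = 16 * (z - x * y) ^ 2 * ((1 - X ^ 2) * (1 - Y ^ 2)) := by ring
  exact le_of_mul_le_mul_right chain (mul_pos h1X h1Y)

/-- Coupled upper window for a normalised cosine: for radii `r ∈ [0.98, 1.02]`,
`s ∈ [0.98, R]` (`s ≤ 1.02`) and a distance `d ≥ 0.98`,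
`(r² + s² − d²)/2 ≤ X(R) · r s` with `X(R) = (1.02² + R² − 0.98²)/(2 · 1.02 · R)`. -/
private theorem cos_le_upper {r s d R : ℝ} (hr1 : 1 - 1 / 50 ≤ r) (hr2 : r ≤ 1 + 1 / 50)
    (hs1 : 1 - 1 / 50 ≤ s) (hs2 : s ≤ 1 + 1 / 50) (hsR : s ≤ R) (hd : 1 - 1 / 50 ≤ d) :
    (r ^ 2 + s ^ 2 - d ^ 2) / 2 ≤
      ((1 + 1 / 50) ^ 2 + R ^ 2 - (1 - 1 / 50) ^ 2) / (2 * (1 + 1 / 50) * R) * (r * s) := by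
  have hR : 0 < R := by linarith
  have hd2 : (1 - 1 / 50) ^ 2 ≤ d ^ 2 := pow_le_pow_left₀ (by norm_num) hd 2
  have h1 : 0 ≤ (1 + 1 / 50) * R * (d ^ 2 - (1 - 1 / 50) ^ 2) :=
    mul_nonneg (by positivity) (sub_nonneg.2 hd2)
  have h2 : 0 ≤ r * ((R - s) * (s * R - 2 / 25)) :=
    mul_nonneg (by linarith) (mul_nonneg (by linarith) (by nlinarith))
  have h3 : 0 ≤ R * ((1 + 1 / 50 - r) * ((1 + 1 / 50) * r - s ^ 2 + (1 - 1 / 50) ^ 2)) :=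
    mul_nonneg hR.le (mul_nonneg (by linarith) (by nlinarith))
  rw [div_mul_eq_mul_div, le_div_iff₀ (by positivity)]
  have key : ((1 + 1 / 50) ^ 2 + R ^ 2 - (1 - 1 / 50) ^ 2) * (r * s) -
      (r ^ 2 + s ^ 2 - d ^ 2) / 2 * (2 * (1 + 1 / 50) * R) =
      (1 + 1 / 50) * R * (d ^ 2 - (1 - 1 / 50) ^ 2) + r * ((R - s) * (s * R - 2 / 25)) +
        R * ((1 + 1 / 50 - r) * ((1 + 1 / 50) * r - s ^ 2 + (1 - 1 / 50) ^ 2)) := by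
    ring
  linarith [key, h1, h2, h3]

/-- Coupled lower window for a normalised cosine: for radii `r ∈ [R₁, 1.02]`, `s ∈ [S₁, 1.02]`
(`R₁, S₁ ≥ 0.98`) and a distance `d ≤ 1.02`,
`Z(R₁, S₁) · r s ≤ (r² + s² − d²)/2` with `Z(R₁, S₁) = (R₁² + S₁² − 1.02²)/(2 R₁ S₁)`. -/
private theorem lower_le_cos {r s d R₁ S₁ : ℝ} (hR₁ : 1 - 1 / 50 ≤ R₁) (hr1 : R₁ ≤ r)
    (hr2 : r ≤ 1 + 1 / 50) (hS₁ : 1 - 1 / 50 ≤ S₁) (hs1 : S₁ ≤ s) (hs2 : s ≤ 1 + 1 / 50)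
    (hd0 : 0 ≤ d) (hd : d ≤ 1 + 1 / 50) :
    (R₁ ^ 2 + S₁ ^ 2 - (1 + 1 / 50) ^ 2) / (2 * R₁ * S₁) * (r * s) ≤
      (r ^ 2 + s ^ 2 - d ^ 2) / 2 := by
  have hR : 0 < R₁ := by linarith
  have hS : 0 < S₁ := by linarith
  have hd2 : d ^ 2 ≤ (1 + 1 / 50) ^ 2 := pow_le_pow_left₀ hd0 hd 2
  have hs2' : s ^ 2 ≤ (1 + 1 / 50) ^ 2 := pow_le_pow_left₀ (by linarith) hs2 2
  have hr2' : R₁ ^ 2 ≤ (1 + 1 / 50) ^ 2 := pow_le_pow_left₀ hR.le (hr1.trans hr2) 2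
  have h1 : 0 ≤ R₁ * S₁ * ((1 + 1 / 50) ^ 2 - d ^ 2) :=
    mul_nonneg (by positivity) (sub_nonneg.2 hd2)
  have h2 : 0 ≤ S₁ * ((r - R₁) * (r * R₁ + (1 + 1 / 50) ^ 2 - s ^ 2)) :=
    mul_nonneg hS.le (mul_nonneg (by linarith) (by nlinarith))
  have h3 : 0 ≤ r * ((s - S₁) * (s * S₁ + (1 + 1 / 50) ^ 2 - R₁ ^ 2)) :=
    mul_nonneg (by linarith) (mul_nonneg (by linarith) (by nlinarith))
  rw [div_mul_eq_mul_div, div_le_iff₀ (by positivity), div_mul_eq_mul_div,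
    le_div_iff₀ (by norm_num : (0 : ℝ) < 2)]
  have key : (r ^ 2 + s ^ 2 - d ^ 2) * (2 * R₁ * S₁) -
      (R₁ ^ 2 + S₁ ^ 2 - (1 + 1 / 50) ^ 2) * (r * s) * 2 =
      2 * (R₁ * S₁ * ((1 + 1 / 50) ^ 2 - d ^ 2) +
        S₁ * ((r - R₁) * (r * R₁ + (1 + 1 / 50) ^ 2 - s ^ 2)) +
        r * ((s - S₁) * (s * S₁ + (1 + 1 / 50) ^ 2 - R₁ ^ 2))) := by
    ring
  linarith [key, h1, h2, h3]

/-! ### The T-corner bound -/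

/-- **T-corner bound (coupled).**  For `v, a, b ∈ ℝ³` with all of `‖v‖, ‖a‖, ‖b‖, dist v a,
dist v b, dist a b` in `[0.98, 1.02]`, the dihedral angle about the spoke `0v` of the tetrahedron
`(0, v, a, b)` — the angle between the components of `a` and `b` orthogonal to `v` — is at most
`arccos (1/4) ≈ 75.52°`. -/
theorem stub_tCornerMax (v a b : EuclideanSpace ℝ (Fin 3))
    (hv : 1 - 1 / 50 ≤ ‖v‖ ∧ ‖v‖ ≤ 1 + 1 / 50) (ha : 1 - 1 / 50 ≤ ‖a‖ ∧ ‖a‖ ≤ 1 + 1 / 50)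
    (hb : 1 - 1 / 50 ≤ ‖b‖ ∧ ‖b‖ ≤ 1 + 1 / 50)
    (hva : 1 - 1 / 50 ≤ dist v a ∧ dist v a ≤ 1 + 1 / 50) (hvb : 1 - 1 / 50 ≤ dist v b ∧ dist v b ≤ 1 + 1 / 50)
    (hab : 1 - 1 / 50 ≤ dist a b ∧ dist a b ≤ 1 + 1 / 50) :
    InnerProductGeometry.angle (perpTo v a) (perpTo v b) ≤ Real.arccos (1 / 4) := by
  -- radii, Gram entries
  have hrv : 0 < ‖v‖ := by linarith [hv.1]
  have hra : 0 < ‖a‖ := by linarith [ha.1]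
  have hrb : 0 < ‖b‖ := by linarith [hb.1]
  have hv0 : v ≠ 0 := norm_pos_iff.1 hrv
  have hvv : ⟪v, v⟫ = ‖v‖ ^ 2 := real_inner_self_eq_norm_sq v
  have haa : ⟪a, a⟫ = ‖a‖ ^ 2 := real_inner_self_eq_norm_sq a
  have hbb : ⟪b, b⟫ = ‖b‖ ^ 2 := real_inner_self_eq_norm_sq b
  have gva : ⟪v, a⟫ = (‖v‖ ^ 2 + ‖a‖ ^ 2 - dist v a ^ 2) / 2 := by
    rw [dist_eq_norm, norm_sub_sq_real]; ring
  have gvb : ⟪v, b⟫ = (‖v‖ ^ 2 + ‖b‖ ^ 2 - dist v b ^ 2) / 2 := by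
    rw [dist_eq_norm, norm_sub_sq_real]; ring
  have gab : ⟪a, b⟫ = (‖a‖ ^ 2 + ‖b‖ ^ 2 - dist a b ^ 2) / 2 := by
    rw [dist_eq_norm, norm_sub_sq_real]; ring
  -- normalised cosines
  obtain ⟨x, hx⟩ : ∃ x : ℝ, ⟪v, a⟫ = x * (‖v‖ * ‖a‖) :=
    ⟨⟪v, a⟫ / (‖v‖ * ‖a‖), (div_mul_cancel₀ _ (mul_pos hrv hra).ne').symm⟩
  obtain ⟨y, hy⟩ : ∃ y : ℝ, ⟪v, b⟫ = y * (‖v‖ * ‖b‖) :=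
    ⟨⟪v, b⟫ / (‖v‖ * ‖b‖), (div_mul_cancel₀ _ (mul_pos hrv hrb).ne').symm⟩
  obtain ⟨z, hz⟩ : ∃ z : ℝ, ⟪a, b⟫ = z * (‖a‖ * ‖b‖) :=
    ⟨⟪a, b⟫ / (‖a‖ * ‖b‖), (div_mul_cancel₀ _ (mul_pos hra hrb).ne').symm⟩
  -- the projections in terms of `x, y, z`
  have hPaa : ⟪perpTo v a, perpTo v a⟫ = ‖a‖ ^ 2 * (1 - x ^ 2) := by
    rw [inner_perpTo_self hv0, haa, hx, hvv]
    field_simp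
  have hPbb : ⟪perpTo v b, perpTo v b⟫ = ‖b‖ ^ 2 * (1 - y ^ 2) := by
    rw [inner_perpTo_self hv0, hbb, hy, hvv]
    field_simp
  have hPab : ⟪perpTo v a, perpTo v b⟫ = ‖a‖ * ‖b‖ * (z - x * y) := by
    have h : ⟪perpTo v a, perpTo v b⟫ = ⟪a, b⟫ - ⟪v, a⟫ / ⟪v, v⟫ * ⟪v, b⟫ := by
      conv_lhs => rw [perpTo_def v b]
      rw [inner_sub_right, real_inner_smul_right, inner_perpTo_left, mul_zero, sub_zero,
        perpTo_def, inner_sub_left, real_inner_smul_left]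
    rw [h, hz, hx, hy, hvv]
    field_simp
  -- windows for `x, y, z`
  have hd0 : ∀ p q : EuclideanSpace ℝ (Fin 3), 0 ≤ dist p q := fun p q => dist_nonneg
  have hx0 : 11 / 25 ≤ x := by
    have h := lower_le_cos (le_refl (1 - 1 / 50 : ℝ)) hv.1 hv.2 (le_refl (1 - 1 / 50 : ℝ))
      ha.1 ha.2 (hd0 v a) hva.2
    rw [← gva, hx] at h
    exact le_trans (by norm_num) (le_of_mul_le_mul_right h (mul_pos hrv hra))
  have hy0 : 11 / 25 ≤ y := by
    have h := lower_le_cos (le_refl (1 - 1 / 50 : ℝ)) hv.1 hv.2 (le_refl (1 - 1 / 50 : ℝ))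
      hb.1 hb.2 (hd0 v b) hvb.2
    rw [← gvb, hy] at h
    exact le_trans (by norm_num) (le_of_mul_le_mul_right h (mul_pos hrv hrb))
  have hz1 : z ≤ 27 / 50 := by
    have h := cos_le_upper ha.1 ha.2 hb.1 hb.2 hb.2 hab.1
    rw [← gab, hz] at h
    exact le_trans (le_of_mul_le_mul_right h (mul_pos hra hrb)) (by norm_num)
  have hxX : ∀ R : ℝ, ‖a‖ ≤ R →
      x ≤ ((1 + 1 / 50) ^ 2 + R ^ 2 - (1 - 1 / 50) ^ 2) / (2 * (1 + 1 / 50) * R) := by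
    intro R hR
    have h := cos_le_upper hv.1 hv.2 ha.1 ha.2 hR hva.1
    rw [← gva, hx] at h
    exact le_of_mul_le_mul_right h (mul_pos hrv hra)
  have hyY : ∀ S : ℝ, ‖b‖ ≤ S →
      y ≤ ((1 + 1 / 50) ^ 2 + S ^ 2 - (1 - 1 / 50) ^ 2) / (2 * (1 + 1 / 50) * S) := by
    intro S hS
    have h := cos_le_upper hv.1 hv.2 hb.1 hb.2 hS hvb.1
    rw [← gvb, hy] at h
    exact le_of_mul_le_mul_right h (mul_pos hrv hrb)
  have hZz : ∀ R₁ S₁ : ℝ, 1 - 1 / 50 ≤ R₁ → R₁ ≤ ‖a‖ → 1 - 1 / 50 ≤ S₁ → S₁ ≤ ‖b‖ →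
      (R₁ ^ 2 + S₁ ^ 2 - (1 + 1 / 50) ^ 2) / (2 * R₁ * S₁) ≤ z := by
    intro R₁ S₁ hR₁ hR₁a hS₁ hS₁b
    have h := lower_le_cos hR₁ hR₁a ha.2 hS₁ hS₁b hb.2 (hd0 a b) hab.2
    rw [← gab, hz] at h
    exact le_of_mul_le_mul_right h (mul_pos hra hrb)
  -- the four boxes
  obtain ⟨hpos, hineq⟩ : 0 < z - x * y ∧ (1 - x ^ 2) * (1 - y ^ 2) ≤ 16 * (z - x * y) ^ 2 := by
    rcases le_total ‖a‖ (99 / 100) with h1 | h1 <;> rcases le_total ‖b‖ (99 / 100) with h2 | h2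
    · exact box_reduce hx0 (hxX _ h1) (by norm_num) hy0 (hyY _ h2) (by norm_num)
        (hZz _ _ le_rfl ha.1 le_rfl hb.1) hz1 (by norm_num) (by norm_num)
    · exact box_reduce hx0 (hxX _ h1) (by norm_num) hy0 (hyY _ hb.2) (by norm_num)
        (hZz _ _ le_rfl ha.1 (by norm_num) h2) hz1 (by norm_num) (by norm_num)
    · exact box_reduce hx0 (hxX _ ha.2) (by norm_num) hy0 (hyY _ h2) (by norm_num)
        (hZz _ _ (by norm_num) h1 le_rfl hb.1) hz1 (by norm_num) (by norm_num)
    · exact box_reduce hx0 (hxX _ ha.2) (by norm_num) hy0 (hyY _ hb.2) (by norm_num)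
        (hZz _ _ (by norm_num) h1 (by norm_num) h2) hz1 (by norm_num) (by norm_num)
  -- conclusion
  have hx1 : x ^ 2 < 1 := by
    have := hxX _ ha.2
    nlinarith [this, hx0]
  have hy1 : y ^ 2 < 1 := by
    have := hyY _ hb.2
    nlinarith [this, hy0]
  have hna : 0 < ‖perpTo v a‖ := by
    refine norm_pos_iff.2 (real_inner_self_pos.1 ?_)
    rw [hPaa]
    exact mul_pos (pow_pos hra 2) (by linarith)
  have hnb : 0 < ‖perpTo v b‖ := by
    refine norm_pos_iff.2 (real_inner_self_pos.1 ?_)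
    rw [hPbb]
    exact mul_pos (pow_pos hrb 2) (by linarith)
  have h4pos : 0 ≤ 4 * ⟪perpTo v a, perpTo v b⟫ := by
    rw [hPab]
    exact mul_nonneg (by norm_num) (mul_nonneg (mul_nonneg hra.le hrb.le) hpos.le)
  have hsq : (‖perpTo v a‖ * ‖perpTo v b‖) ^ 2 ≤ (4 * ⟪perpTo v a, perpTo v b⟫) ^ 2 := by
    rw [mul_pow, ← real_inner_self_eq_norm_sq, ← real_inner_self_eq_norm_sq, hPaa, hPbb, hPab]
    have h := mul_le_mul_of_nonneg_left hineq (by positivity : (0 : ℝ) ≤ ‖a‖ ^ 2 * ‖b‖ ^ 2)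
    calc ‖a‖ ^ 2 * (1 - x ^ 2) * (‖b‖ ^ 2 * (1 - y ^ 2))
        = ‖a‖ ^ 2 * ‖b‖ ^ 2 * ((1 - x ^ 2) * (1 - y ^ 2)) := by ring
      _ ≤ ‖a‖ ^ 2 * ‖b‖ ^ 2 * (16 * (z - x * y) ^ 2) := h
      _ = (4 * (‖a‖ * ‖b‖ * (z - x * y))) ^ 2 := by ring
  have h4 : ‖perpTo v a‖ * ‖perpTo v b‖ ≤ 4 * ⟪perpTo v a, perpTo v b⟫ :=
    (pow_le_pow_iff_left₀ (by positivity) h4pos two_ne_zero).1 hsq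
  unfold InnerProductGeometry.angle
  apply Real.arccos_le_arccos
  rw [le_div_iff₀ (mul_pos hna hnb)]
  linarith
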